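import Summits.NavierStokesRegularity.TurbBounds.Results.FSU1
import Summits.NavierStokesRegularity.TurbBounds.FSU1.Mode.M18ModeLemma
import HarnessLib

/-!
# Row FS-U1″ from the CITED free-slip reduction ALONE: `FreeSlipReduction Nu → FSU1Claim Nu`,
# and the free-slip spectral constraint itself, unconditional

(cell `pub-turb` / `turb-bounds`, v2 lane, row 6; composition file over `Results/FSU1.lean`
(B1″, LEAD decision 114 (B)) and `FSU1/Mode/M18ModeLemma.lean` (B1‴, LEAD decision 122), in the
pattern of `Results/N0Spectral.lean` and `Results/P2Spectral.lean`. Written by pub-turb-sos,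
planner-pub-turb-sos-g22-0, 2026-08-22.)

HONEST FRAMING: rigorous bounds for the stated PDE and boundary conditions; no claim about
physical turbulence beyond the bound.

RESULT.
* `Results.FSU1.spectralConstraintFS_holds (hRa : 10⁶ ≤ Ra) :
  SpectralConstraintFS Ra p0.a p0.b (tauFS p0.D Ra)` — for the parameters of record
  `p0 = (a, b, D, ρ_I, u_I) = (129/250, 1/5, 41/10, 44627207783781/5·10¹³, 1/3)` and the two-layer
  background profile `tauFS p0.D Ra` (boundary layers of thickness `δ = D·Ra^{−5/12}`), the
  free-slip mode form of the background method is `≥ 0` for EVERY wavenumber `k > 0` on the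
  free-slip class, at every `Ra ≥ 10⁶` — UNCONDITIONAL: the finite part (481 cell inequalities,
  the corner, the cover, the scalar lines; `FSU1/*`, exact rational criteria run by the kernel)
  and the per-mode analytic lemma (`FSU1.Mode.fsu1ModeLemma`; FS-PROOF-DRAFT §3.2–3.9 formalised
  in `FSU1/Mode/M01…M18`) are both theorems of the tree.
* `Results.FSU1.nusselt_bound_of_freeSlipReduction (hRed : FreeSlipReduction Nu) : FSU1Claim Nu`
  — row FS-U1″, `Nu(Ra) ≤ (25/164)·Ra^{5/12} − 1/4` for every `Ra ≥ 10⁶` (2-D Rayleigh–Bénard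
  convection between free-slip isothermal walls, any Prandtl number, any horizontal period), from
  ONE hypothesis, which is the published free-slip background reduction transcribed mode-wise
  [Whitehead–Doering, Phys. Rev. Lett. 106 (2011) 244501, p. 3]
  (`SpectralFormFreeSlip.FreeSlipReduction`, B1′, p324988).

NOT CLAIMED: the PDE energy argument (free-slip background decomposition ⇒ Nusselt bound) —
that IS the hypothesis, cited; nothing about no-slip walls or three dimensions.
-/

namespace Summit.NavierStokesRegularity.TurbBounds.Results.FSU1

open Summit.NavierStokesRegularity.TurbBounds.SpectralFormFreeSlip
open Summit.NavierStokesRegularity.TurbBounds.FSU1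

/-- **The free-slip spectral constraint for row FS-U1″, unconditional**: for the parameters of
record `p0` and every `Ra ≥ 10⁶`, the free-slip mode form with the two-layer profile
`tauFS p0.D Ra` is `≥ 0` on the free-slip class for EVERY `k > 0` — the analytic hypothesis
`FSU1ModeLemma` of `spectralConstraintFS_p0` discharged BY NAME by `FSU1.Mode.fsu1ModeLemma`. -/
theorem spectralConstraintFS_holds {Ra : ℝ} (hRa : (10 : ℝ) ^ 6 ≤ Ra) :
    SpectralConstraintFS Ra p0.a p0.b (tauFS p0.D Ra) :=
  spectralConstraintFS_p0 FSU1.Mode.fsu1ModeLemma hRa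

/-- **ROW FS-U1″ from the cited theorem alone**: for every quantity `Nu` obeying the free-slip
background reduction in mode form (`FreeSlipReduction`; Whitehead–Doering 2011),
`Nu(Ra) ≤ (25/164)·Ra^{5/12} − 1/4` for every `Ra ≥ 10⁶` (2-D, free-slip isothermal walls, any
Prandtl number, any horizontal period). ONE hypothesis = the cited reduction; everything below
it is kernel-checked (`Results.FSU1.nusselt_bound` with its analytic hypothesis supplied by
`FSU1.Mode.fsu1ModeLemma`). -/
theorem nusselt_bound_of_freeSlipReduction (Nu : ℝ → ℝ) (hRed : FreeSlipReduction Nu) :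
    FSU1Claim Nu :=
  nusselt_bound Nu hRed FSU1.Mode.fsu1ModeLemma

/-- SHAPE GUARD: exactly the advertised shape `∀ Nu, FreeSlipReduction Nu → FSU1Claim Nu`. -/
example : ∀ Nu : ℝ → ℝ, FreeSlipReduction Nu → FSU1Claim Nu :=
  nusselt_bound_of_freeSlipReduction

/-- UNFOLDED GUARD: `FSU1Claim` is the displayed inequality at every `Ra ≥ 10⁶`. -/
example (Nu : ℝ → ℝ) (hRed : FreeSlipReduction Nu) {Ra : ℝ} (hRa : (10 : ℝ) ^ 6 ≤ Ra) :
    Nu Ra ≤ 25 / 164 * Ra ^ ((5 : ℝ) / 12) - 1 / 4 :=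
  nusselt_bound_of_freeSlipReduction Nu hRed Ra hRa

/-- VACUITY GUARD: the one hypothesis is satisfiable as typed (conduction value). -/
example : ∃ Nu, FreeSlipReduction Nu := freeSlipReduction_satisfiable

end Summit.NavierStokesRegularity.TurbBounds.Results.FSU1
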